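import Literature.MathematicalPhysics.QuantumFieldTheory.PlaquetteWeightTorusDobrushin
import Literature.MathematicalPhysics.QuantumFieldTheory.LatticeGaugePlaquetteLowerBound
import Literature.MathematicalPhysics.QuantumFieldTheory.LatticeGaugeDobrushinPoincare
import HarnessLib

/-!
# Robust ball (Y2), strong-coupling laws — torus geometry for the energy-variance floor

HONEST FRAMING: venture file of the cell `pub-ymgap` (QuantumFields programme), track ROBUST-BALL, seat rb-p2 (g8).  Elementary
combinatorics and algebra of the torus Wilson action `S_W = ∑_q (N − Re tr ρ(U_q))` on `(ℤ/Lℤ)^d` (tree objects `Plaquette`,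
`plaquetteHolonomy`, `wilsonAction`, `plaqEdgesT`, `plaqsThrough`), feeding the inverse Efron–Stein inequality
(`EnergyVarianceBessel`, `EnergyVarianceGibbsFloor`) in `EnergyVarianceTorus.lean`.  LATTICE bookkeeping only; nothing about the
continuum, a spectral gap or the Clay problem.

* `wilsonAction_update_update_sub` — the Wilson action is ADDITIVELY SEPARABLE in two links lying on no common plaquette;
* `abs_wilsonAction_update_sub_le` — its one-link oscillation is `≤ 4(d−1)N` (`≤ 2(d−1)` plaquettes through a link, `|Re tr| ≤ N`);
* `mem_plaqEdgesT_same_dir` — two links of the same direction `i` on a common plaquette have equal base points or base points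
  differing by a unit step in a direction `≠ i`; hence (`pairwise_separated_of_sparse`) the direction-`i` links based at a set of
  sites no two of which differ by a unit step lie pairwise on no common plaquette;
* `eq_basePlaquette_of_mem_of_mem` (`L ≥ 2`) — the plaquette `(x; i<j)` is the ONLY plaquette containing both `(x,i)` and `(x,j)`
  (the link `(x,j)` is PRIVATE to it among the plaquettes through `(x,i)`), and `plaquetteHolonomy_base_update_update` — on it the
  holonomy reads `h · a · h'⁻¹` in the variables `h` at `(x,i)` and `h'` at `(x,j)`.

References: E. Seiler, LNP 159 (1982), Ch. 2; H. Shen, R. Zhu, X. Zhu, CMP 400 (2023) §2 (plaquette neighbours of a link).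
Everything here is proved. [folklore]
-/

noncomputable section

open Finset Function
open Literature.MathematicalPhysics.QuantumFieldTheory

namespace Summit.Ventures.YMGap.RobustBall

namespace EnergyVariance

variable {d L N : ℕ} {G : Type*} [Group G] (ρ : G →* Matrix (Fin N) (Fin N) ℂ)

/-! ### Shifts on the torus of side `L ≥ 2` -/

omit [Group G] in
/-- On a torus of side `L ≥ 2` a unit shift moves every site. [folklore] -/
theorem shift_ne_self (hL : 1 < L) (x : Site d L) (k : Fin d) : x.shift k ≠ x := by
  haveI : Fact (1 < L) := ⟨hL⟩
  intro h
  have h1 : (x.shift k) k = x k := by rw [h]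
  simp only [Site.shift, Pi.add_apply, Pi.single_eq_same, add_eq_left] at h1
  exact one_ne_zero h1

omit [Group G] in
/-- On a torus of side `L ≥ 2` the direction of a unit shift is determined by the shift. [folklore] -/
theorem shift_injective_dir (hL : 1 < L) (x : Site d L) {a b : Fin d} (h : x.shift a = x.shift b) : a = b := by
  haveI : Fact (1 < L) := ⟨hL⟩
  by_contra hab
  have h1 : (x.shift a) a = (x.shift b) a := by rw [h]
  simp only [Site.shift, Pi.add_apply, Pi.single_eq_same, Pi.single_eq_of_ne hab, add_zero, add_eq_left] at h1
  exact one_ne_zero h1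

/-! ### Separability and one-link oscillation of the Wilson action -/

section Action

variable [NeZero L]

/-- **Additive separability of the Wilson action in two links on no common plaquette**: if no plaquette contains both `e` and
`e'`, then `S_W(U^{e'←y, e←z}) − S_W(U^{e←z}) = S_W(U^{e'←y}) − S_W(U)` for all `y, z` (each plaquette reads at most one of the
two links). [folklore] -/
theorem wilsonAction_update_update_sub {e e' : Edge d L} (h : ∀ q : Plaquette d L, e ∈ plaqEdgesT q → e' ∉ plaqEdgesT q)
    (U : GaugeConfig d L G) (y z : G) :
    wilsonAction ρ (update (update U e' y) e z) - wilsonAction ρ (update U e z) =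
      wilsonAction ρ (update U e' y) - wilsonAction ρ U := by
  unfold wilsonAction
  rw [← Finset.sum_sub_distrib, ← Finset.sum_sub_distrib]
  refine Finset.sum_congr rfl fun q _ => ?_
  by_cases hq : e ∈ plaqEdgesT q
  · have he' : e' ∉ plaqEdgesT q := h q hq
    have hne : e' ≠ e := by rintro rfl; exact he' hq
    rw [update_comm hne, plaquetteHolonomy_update_of_not_mem he', plaquetteHolonomy_update_of_not_mem he', sub_self,
      sub_self]
  · rw [plaquetteHolonomy_update_of_not_mem hq, plaquetteHolonomy_update_of_not_mem hq]

/-- **One-link oscillation of the Wilson action**: for unitary `ρ`, changing one link changes `S_W` by at most `4(d−1)N`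
(at most `2(d−1)` plaquettes contain the link, `|Re tr ρ| ≤ N` on each). [folklore] -/
theorem abs_wilsonAction_update_sub_le (hρu : ∀ g, ρ g ∈ Matrix.unitaryGroup (Fin N) ℂ) (e : Edge d L)
    (U : GaugeConfig d L G) (g g' : G) :
    |wilsonAction ρ (update U e g) - wilsonAction ρ (update U e g')| ≤ 4 * (d - 1 : ℕ) * N := by
  classical
  unfold wilsonAction
  rw [← Finset.sum_sub_distrib]
  set t : Plaquette d L → ℝ := fun q =>
    ((N : ℝ) - (ρ (plaquetteHolonomy (update U e g) q.1 q.2.1.1 q.2.1.2)).trace.re) -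
      ((N : ℝ) - (ρ (plaquetteHolonomy (update U e g') q.1 q.2.1.1 q.2.1.2)).trace.re) with ht
  have hzero : ∀ q ∉ plaqsThrough e, t q = 0 := fun q hq => by
    rw [mem_plaqsThrough] at hq
    simp only [ht, plaquetteHolonomy_update_of_not_mem hq, sub_self]
  have hsum : ∑ q, t q = ∑ q ∈ plaqsThrough e, t q :=
    (Finset.sum_subset (Finset.subset_univ _) fun q _ hq => hzero q hq).symm
  have hterm : ∀ q ∈ plaqsThrough e, |t q| ≤ 2 * N := fun q _ => by
    have h1 := PlaquetteLowerBound.abs_reTr_le ρ hρu (plaquetteHolonomy (update U e g) q.1 q.2.1.1 q.2.1.2)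
    have h2 := PlaquetteLowerBound.abs_reTr_le ρ hρu (plaquetteHolonomy (update U e g') q.1 q.2.1.1 q.2.1.2)
    simp only [PlaquetteLowerBound.reTr] at h1 h2
    simp only [ht]
    rw [abs_le] at h1 h2 ⊢
    constructor <;> linarith [h1.1, h1.2, h2.1, h2.2]
  change |∑ q, t q| ≤ _
  rw [hsum]
  calc |∑ q ∈ plaqsThrough e, t q| ≤ ∑ q ∈ plaqsThrough e, |t q| := Finset.abs_sum_le_sum_abs _ _
    _ ≤ ∑ _q ∈ plaqsThrough e, 2 * (N : ℝ) := Finset.sum_le_sum hterm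
    _ = (plaqsThrough e).card * (2 * N) := by rw [Finset.sum_const, nsmul_eq_mul]
    _ ≤ (2 * (d - 1 : ℕ) : ℕ) * (2 * N) := by
        have hc : ((plaqsThrough e).card : ℝ) ≤ ((2 * (d - 1) : ℕ) : ℝ) := by exact_mod_cast card_plaqsThrough_le e
        exact mul_le_mul_of_nonneg_right hc (by positivity)
    _ = 4 * (d - 1 : ℕ) * N := by push_cast; ring

end Action

/-! ### Links of one direction: common plaquettes, sparse site sets -/

omit [Group G] in
/-- **Two links of the same direction on a common plaquette**: if `(x, i)` and `(x', i)` both lie on the plaquette `q`, then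
`x' = x`, or the base points differ by a unit step in a direction `k ≠ i` (`x' = x + e_k` or `x = x' + e_k`). [folklore] -/
theorem mem_plaqEdgesT_same_dir {x x' : Site d L} {i : Fin d} {q : Plaquette d L}
    (hx : (x, i) ∈ plaqEdgesT q) (hx' : (x', i) ∈ plaqEdgesT q) :
    x' = x ∨ ∃ k : Fin d, k ≠ i ∧ (x' = x.shift k ∨ x = x'.shift k) := by
  obtain ⟨y, ⟨a, b⟩, hab⟩ := q
  have hne : a ≠ b := ne_of_lt hab
  simp only [plaqEdgesT, mem_insert, mem_singleton, Prod.mk.injEq] at hx hx'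
  rcases hx with ⟨hx1, hi⟩ | ⟨hx1, hi⟩ | ⟨hx1, hi⟩ | ⟨hx1, hi⟩ <;>
    rcases hx' with ⟨hx2, hi'⟩ | ⟨hx2, hi'⟩ | ⟨hx2, hi'⟩ | ⟨hx2, hi'⟩
  all_goals first
    | exact Or.inl (hx2.trans hx1.symm)
    | exact absurd (hi.symm.trans hi') hne
    | exact absurd (hi'.symm.trans hi) hne
    | exact Or.inr ⟨b, fun h => hne (h.trans hi).symm, Or.inl (hx2.trans (congrArg (·.shift b) hx1).symm)⟩
    | exact Or.inr ⟨a, fun h => hne (h.trans hi), Or.inl (hx2.trans (congrArg (·.shift a) hx1).symm)⟩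
    | exact Or.inr ⟨b, fun h => hne (h.trans hi).symm, Or.inr (hx1.trans (congrArg (·.shift b) hx2).symm)⟩
    | exact Or.inr ⟨a, fun h => hne (h.trans hi), Or.inr (hx1.trans (congrArg (·.shift a) hx2).symm)⟩

omit [Group G] in
/-- **Sparse site sets give pairwise separated links**: if no two sites of `S` differ by a unit step in a direction `≠ i`, then
two distinct direction-`i` links based in `S` lie on no common plaquette. [folklore] -/
theorem pairwise_separated_of_sparse {i : Fin d} {S : Finset (Site d L)}
    (hS : ∀ x ∈ S, ∀ x' ∈ S, ∀ k : Fin d, k ≠ i → x' ≠ x.shift k) {x x' : Site d L} (hx : x ∈ S) (hx' : x' ∈ S)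
    (hxx' : x ≠ x') (q : Plaquette d L) (h : (x, i) ∈ plaqEdgesT q) : (x', i) ∉ plaqEdgesT q := by
  intro h'
  rcases mem_plaqEdgesT_same_dir h h' with h1 | ⟨k, hk, h1 | h1⟩
  · exact hxx' h1.symm
  · exact hS x hx x' hx' k hk h1
  · exact hS x' hx' x hx k hk h1

/-! ### The base plaquette `(x; i<j)`: privacy of the link `(x, j)` and the holonomy in the two variables -/

omit [Group G] in
/-- The base plaquette `(x; i<j)` contains the links `(x, i)` and `(x, j)`. [folklore] -/
theorem mem_plaqEdgesT_base (x : Site d L) {i j : Fin d} (hij : i < j) :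
    (x, i) ∈ plaqEdgesT ((x, ⟨(i, j), hij⟩) : Plaquette d L) ∧ (x, j) ∈ plaqEdgesT ((x, ⟨(i, j), hij⟩) : Plaquette d L) := by
  simp [plaqEdgesT]

omit [Group G] in
/-- **Privacy** (`L ≥ 2`): the base plaquette `(x; i<j)` is the only plaquette of the torus containing both `(x, i)` and `(x, j)`.
[folklore] -/
theorem eq_basePlaquette_of_mem_of_mem (hL : 1 < L) {x : Site d L} {i j : Fin d} (hij : i < j) {q : Plaquette d L}
    (hi : (x, i) ∈ plaqEdgesT q) (hj : (x, j) ∈ plaqEdgesT q) : q = (x, ⟨(i, j), hij⟩) := by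
  obtain ⟨y, ⟨a, b⟩, hab⟩ := q
  have hne : a ≠ b := ne_of_lt hab
  have hij' : i ≠ j := ne_of_lt hij
  simp only [plaqEdgesT, mem_insert, mem_singleton, Prod.mk.injEq] at hi hj
  rcases hi with ⟨hx1, hi⟩ | ⟨hx1, hi⟩ | ⟨hx1, hi⟩ | ⟨hx1, hi⟩ <;>
    rcases hj with ⟨hx2, hj⟩ | ⟨hx2, hj⟩ | ⟨hx2, hj⟩ | ⟨hx2, hj⟩
  all_goals first
    | exact absurd (hi.trans hj.symm) hij'
    | exact absurd hij (lt_asymm (lt_of_lt_of_eq (lt_of_eq_of_lt hj hab) hi.symm))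
    | exact absurd (hx1.symm.trans hx2).symm (shift_ne_self hL y a)
    | exact absurd (hx1.symm.trans hx2).symm (shift_ne_self hL y b)
    | exact absurd (hx2.symm.trans hx1).symm (shift_ne_self hL y a)
    | exact absurd (hx2.symm.trans hx1).symm (shift_ne_self hL y b)
    | exact absurd (shift_injective_dir hL y (hx2.symm.trans hx1)) hne
    | exact absurd (shift_injective_dir hL y (hx1.symm.trans hx2)) hne
    | (subst hi hj hx1; rfl)

/-- **The holonomy of the base plaquette in the two variables** (`L ≥ 2`, `i ≠ j`): with `h` at `(x, i)` and `h'` at `(x, j)`,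
`U_{(x;i,j)} = h · (U(x+e_i, j) U(x+e_j, i)⁻¹) · h'⁻¹`. [folklore] -/
theorem plaquetteHolonomy_base_update_update (hL : 1 < L) {x : Site d L} {i j : Fin d} (hij : i ≠ j)
    (U : GaugeConfig d L G) (h h' : G) :
    plaquetteHolonomy (update (update U (x, j) h') (x, i) h) x i j =
      h * (U (x.shift i, j) * (U (x.shift j, i))⁻¹) * h'⁻¹ := by
  have h1' : ((x.shift i, j) : Edge d L) ≠ (x, i) := by
    intro e; exact hij.symm (congrArg Prod.snd e)
  have h2 : ((x.shift i, j) : Edge d L) ≠ (x, j) := by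
    intro e; exact shift_ne_self hL x i (congrArg Prod.fst e)
  have h3 : ((x.shift j, i) : Edge d L) ≠ (x, i) := by
    intro e; exact shift_ne_self hL x j (congrArg Prod.fst e)
  have h4 : ((x.shift j, i) : Edge d L) ≠ (x, j) := by
    intro e; exact hij (congrArg Prod.snd e)
  have h5 : ((x, j) : Edge d L) ≠ (x, i) := by
    intro e; exact hij.symm (congrArg Prod.snd e)
  unfold plaquetteHolonomy
  rw [update_self, update_of_ne h1', update_of_ne h2, update_of_ne h3, update_of_ne h4, update_of_ne h5, update_self]
  group

end EnergyVariance

end Summit.Ventures.YMGap.RobustBall
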